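import Mathlib
import HarnessLib
import Summits.NavierStokesRegularity.NavierStokesRegularity.Theorems.UnthreadedDoorAntidynamoWallEvenSector

/-!
# Route `UnthreadedDoor` / `ThreadingFlux`, crux `PoloidalLiouville` (stmt-NavierStokesRegularity-1222), antidynamo v2 skeleton
# (sha16 `4ebf5683127b`): THE WALL ON THE EVEN SECTOR — A NON-STAGNANT FAR PAST SUFFICES

Support file (seat leafhand-ns-unthreadeddoor-2 g0, cell decomp-ns), `--supports stmt-NavierStokesRegularity-1222 --as helper`; theorems only.
Continues `…AntidynamoWallEvenSector` (p814555): there the even sector of the wall (vorticity even about the centre `x₀`) was shown irrotational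
when the centre NEVER stagnates, `v(t, x₀) ≠ 0` for all `t < 0` — the all-time hypothesis being what the cell-flux theorem Z (KNSS Thm 5.2 in a
moving frame, an ANCIENT-interval statement) consumes.  Here the hypothesis is weakened to the FAR PAST: it suffices that `v(t, x₀) ≠ 0` for all
`t < t₁`, for SOME `t₁ ≤ 0`.  The shifted field `(s, y) ↦ v(s + t₁, y)` is again in the class (`CellFlux.isBoundedAncientMildSolution_frame` with the
trivial frame; measurability and joint smoothness shift trivially), it is unthreaded with even vorticity, and the orthogonality
`⟪v(t, x₀), curl v(t, ·)⟫ ≡ 0` of p814555 holds at every time; Z on the shifted field gives `curl v(t) ≡ 0` for `t < t₁`, and the tree's forward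
vanishing of the vorticity in the class (`CellFlux.forwardVanishing`, Z-2, PROVED) propagates it to `[t₁, 0)`.

* `timeShift_class` — the class, measurability and joint smoothness of `(s, y) ↦ v(s + t₁, y)`, `t₁ ≤ 0`;
* ★★ `curl_eq_zero_of_curl_even_of_centre_ne_zero_farPast` / `constant_of_curl_even_of_centre_ne_zero_farPast` — even vorticity about `x₀`,
  unthreaded about `x₀`, `∃ t₁ ≤ 0, ∀ t < t₁, v(t, x₀) ≠ 0` ⇒ `curl v ≡ 0` on `(−∞,0) × ℝ³`, constant slices;
* ★★ `stubScalarLiouville_of_even_potential_of_centre_ne_zero_farPast` — the wall's letter: `T(t, ·)` even about `x₀` at every `t < 0` and a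
  non-stagnant far past ⇒ `∇T × (x − x₀) ≡ 0`.

WHAT REMAINS OF THE EVEN SECTOR: flows whose centre stagnates at a sequence of times `tₙ → −∞` (in particular the fully stagnant ones,
`v(t, x₀) = 0` for all `t`, which contain the even single-degree modes with stagnant centre handled by the census's (E1) assembly).
HONEST LABEL: a sector of the wall; nothing here proves `stub_scalarLiouville`, `PoloidalLiouville` (1222), or bears on Navier–Stokes
regularity; no summit statement is proved (crux 1222 is INCOMPARABLE with the summit). [folklore]
[cite: KochNadirashviliSereginSverak2009, Thm 5.2 (arXiv:0709.3599 pp. 9–10)]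
-/

noncomputable section

-- the summit and its single sub-problem share the name (CONVENTIONS §1)
set_option linter.dupNamespace false

open scoped Topology InnerProductSpace RealInnerProductSpace ContDiff
open Filter Set Function Metric MeasureTheory
open Literature.Analysis.FluidPDE

namespace Summit.NavierStokesRegularity.NavierStokesRegularity.Theorems.PoloidalLiouville.Antidynamo

open Summit.NavierStokesRegularity.NavierStokesRegularity.Theorems.PoloidalLiouville
  (toroidalPotential exists_norm_curl_le constantOfIrrotational)

/-! ### Time-shift covariance of the hypotheses -/

/-- **The class is invariant under time shifts into the past**: for `t₁ ≤ 0` the field `(s, y) ↦ v(s + t₁, y)` is a bounded ancient mild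
solution with measurable slices, jointly smooth on `(−∞,0) × ℝ³`, whenever `v` is (`CellFlux.isBoundedAncientMildSolution_frame` with the
identity frame and centre `0`). [folklore] -/
theorem timeShift_class
    {v : ℝ → EuclideanSpace ℝ (Fin 3) → EuclideanSpace ℝ (Fin 3)}
    (hB : Literature.Analysis.FluidPDE.IsBoundedAncientMildSolution 1 v)
    (hm : ∀ t < 0, AEStronglyMeasurable (v t) volume)
    (hsm : ContDiffOn ℝ (⊤ : ℕ∞) (Function.uncurry v) (Set.Iio 0 ×ˢ Set.univ)) {t₁ : ℝ} (ht₁ : t₁ ≤ 0) :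
    Literature.Analysis.FluidPDE.IsBoundedAncientMildSolution 1 (fun s y => v (s + t₁) y) ∧
      (∀ s < 0, AEStronglyMeasurable (fun y => v (s + t₁) y) volume) ∧
      ContDiffOn ℝ (⊤ : ℕ∞) (Function.uncurry fun s y => v (s + t₁) y) (Set.Iio 0 ×ˢ Set.univ) := by
  refine ⟨?_, fun s hs => hm (s + t₁) (by linarith), ?_⟩
  · have h := CellFlux.isBoundedAncientMildSolution_frame hB (LinearIsometryEquiv.refl ℝ (EuclideanSpace ℝ (Fin 3))) 0 ht₁
    have e : (fun s y => (LinearIsometryEquiv.refl ℝ (EuclideanSpace ℝ (Fin 3)))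
        (v (s + t₁) ((LinearIsometryEquiv.refl ℝ (EuclideanSpace ℝ (Fin 3))).symm y + 0))) = fun s y => v (s + t₁) y := by
      funext s y
      have hy : (LinearIsometryEquiv.refl ℝ (EuclideanSpace ℝ (Fin 3))).symm y = y := rfl
      rw [hy, add_zero, LinearIsometryEquiv.coe_refl, id_eq]
    rw [e] at h
    exact h
  · have hmap : ContDiff ℝ (⊤ : ℕ∞) fun p : ℝ × EuclideanSpace ℝ (Fin 3) => (p.1 + t₁, p.2) :=
      (contDiff_fst.add contDiff_const).prodMk contDiff_snd
    have hmaps : MapsTo (fun p : ℝ × EuclideanSpace ℝ (Fin 3) => (p.1 + t₁, p.2)) (Iio 0 ×ˢ univ) (Iio 0 ×ˢ univ) := by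
      intro p hp
      have h1 : p.1 < 0 := hp.1
      exact ⟨show p.1 + t₁ < 0 by linarith, mem_univ _⟩
    exact hsm.comp hmap.contDiffOn hmaps

/-! ### ★★ A non-stagnant far past suffices -/

/-- ★★ **EVEN VORTICITY + NON-STAGNANT FAR PAST ⇒ IRROTATIONAL.**  Let `v` be a bounded ancient mild solution (`ν = 1`, duality class) with
measurable slices, jointly smooth on `(−∞,0) × ℝ³`, unthreaded about `x₀` and with vorticity EVEN under the point reflection about `x₀` at every
`t < 0`.  If for some `t₁ ≤ 0` the centre does not stagnate before `t₁` (`v(t, x₀) ≠ 0` for all `t < t₁`), then `curl v ≡ 0` on `(−∞,0) × ℝ³`.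
[Orthogonality `⟪v(t,x₀), curl v(t,·)⟫ ≡ 0` (p814555) + Z on the time-shifted field for `t < t₁` + `CellFlux.forwardVanishing` for `t ≥ t₁`.]
[cite: KochNadirashviliSereginSverak2009, Thm 5.2 (arXiv:0709.3599 pp. 9–10)] -/
theorem curl_eq_zero_of_curl_even_of_centre_ne_zero_farPast
    (v : ℝ → EuclideanSpace ℝ (Fin 3) → EuclideanSpace ℝ (Fin 3)) (x₀ : EuclideanSpace ℝ (Fin 3))
    (hB : Literature.Analysis.FluidPDE.IsBoundedAncientMildSolution 1 v)
    (hm : ∀ t < 0, AEStronglyMeasurable (v t) volume)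
    (hsm : ContDiffOn ℝ (⊤ : ℕ∞) (Function.uncurry v) (Set.Iio 0 ×ˢ Set.univ))
    (hun : ∀ t < 0, ∀ x, ⟪x - x₀, curl (v t) x⟫ = 0)
    (hev : ∀ t < 0, ∀ x, curl (v t) (x₀ + x₀ - x) = curl (v t) x)
    (hne : ∃ t₁ ≤ 0, ∀ t < t₁, v t x₀ ≠ 0) :
    ∀ t < 0, ∀ x, curl (v t) x = 0 := by
  obtain ⟨t₁, ht₁, hne⟩ := hne
  have horth := inner_centreVelocity_curl_eq_zero_of_curl_even v x₀ hB hm hsm hun hev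
  -- the shifted field `w s = v (s + t₁)`
  obtain ⟨hBw, hmw, hsmw⟩ := timeShift_class hB hm hsm ht₁
  have hunw : ∀ s < 0, ∀ x, ⟪x - x₀, curl ((fun s y => v (s + t₁) y) s) x⟫ = 0 :=
    fun s hs x => hun (s + t₁) (by linarith) x
  obtain ⟨K, hK⟩ := exists_norm_curl_le hBw hsmw
  obtain ⟨T, -, -, hlink⟩ := toroidalPotential (fun s y => v (s + t₁) y) x₀ K hsmw hK hunw
  have hw0 : ∀ s < 0, ∀ x, curl ((fun s y => v (s + t₁) y) s) x = 0 :=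
    CellFlux.zonalUnthreadedVorticityVanishes (fun s y => v (s + t₁) y) x₀ T hBw hmw hsmw hlink fun s hs =>
      ⟨v (s + t₁) x₀, hne (s + t₁) (by linarith), fun x => horth (s + t₁) (by linarith) x⟩
  -- strictly before `t₁`
  have hlt : ∀ t < t₁, ∀ x, curl (v t) x = 0 := fun t ht x => by
    have h := hw0 (t - t₁) (by linarith) x
    simp only [sub_add_cancel] at h
    exact h
  -- from `t₁ − 1` on, by forward vanishing
  intro t ht x
  by_cases htt : t < t₁
  · exact hlt t htt x
  · have htt' : t₁ ≤ t := not_lt.mp htt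
    exact CellFlux.forwardVanishing v hB hm hsm (t₁ - 1) (by linarith) (hlt (t₁ - 1) (by linarith)) t (by linarith) ht x

/-- ★★ **… HENCE SLICE-WISE CONSTANT** (`constantOfIrrotational`). [cite: KochNadirashviliSereginSverak2009, Thm 5.2 (arXiv:0709.3599 pp. 9–10)] -/
theorem constant_of_curl_even_of_centre_ne_zero_farPast
    (v : ℝ → EuclideanSpace ℝ (Fin 3) → EuclideanSpace ℝ (Fin 3)) (x₀ : EuclideanSpace ℝ (Fin 3))
    (hB : Literature.Analysis.FluidPDE.IsBoundedAncientMildSolution 1 v)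
    (hm : ∀ t < 0, AEStronglyMeasurable (v t) volume)
    (hsm : ContDiffOn ℝ (⊤ : ℕ∞) (Function.uncurry v) (Set.Iio 0 ×ˢ Set.univ))
    (hun : ∀ t < 0, ∀ x, ⟪x - x₀, curl (v t) x⟫ = 0)
    (hev : ∀ t < 0, ∀ x, curl (v t) (x₀ + x₀ - x) = curl (v t) x)
    (hne : ∃ t₁ ≤ 0, ∀ t < t₁, v t x₀ ≠ 0) :
    ∀ t < 0, ∃ b : EuclideanSpace ℝ (Fin 3), ∀ x, v t x = b :=
  constantOfIrrotational v hB hsm (curl_eq_zero_of_curl_even_of_centre_ne_zero_farPast v x₀ hB hm hsm hun hev hne)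

/-- ★★ **THE WALL ON THE EVEN SECTOR WITH A NON-STAGNANT FAR PAST** (the letter of `StubScalarLiouville`: class, measurability, joint smoothness,
the representation `curl v = ∇T × (x − x₀)`; (E1), the bound and the smoothness of `T` are not needed).  If `T(t, ·)` is EVEN under the point
reflection about `x₀` for every `t < 0` and `v(t, x₀) ≠ 0` for all `t < t₁`, some `t₁ ≤ 0`, then `∇T(t, x) × (x − x₀) = 0` for all `t < 0`, `x`.
[cite: KochNadirashviliSereginSverak2009, Thm 5.2 (arXiv:0709.3599 pp. 9–10)] -/
theorem stubScalarLiouville_of_even_potential_of_centre_ne_zero_farPast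
    (v : ℝ → EuclideanSpace ℝ (Fin 3) → EuclideanSpace ℝ (Fin 3)) (x₀ : EuclideanSpace ℝ (Fin 3))
    (T : ℝ → EuclideanSpace ℝ (Fin 3) → ℝ)
    (hB : Literature.Analysis.FluidPDE.IsBoundedAncientMildSolution 1 v)
    (hm : ∀ t < 0, AEStronglyMeasurable (v t) volume)
    (hsm : ContDiffOn ℝ (⊤ : ℕ∞) (Function.uncurry v) (Set.Iio 0 ×ˢ Set.univ))
    (hrep : ∀ t < 0, ∀ x, Literature.Analysis.FluidPDE.curl (v t) x =
      Literature.Analysis.FluidPDE.cross (gradient (T t) x) (x - x₀))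
    (hTeven : ∀ t < 0, ∀ x, T t (x₀ + x₀ - x) = T t x)
    (hne : ∃ t₁ ≤ 0, ∀ t < t₁, v t x₀ ≠ 0) :
    ∀ t < 0, ∀ x, Literature.Analysis.FluidPDE.cross (gradient (T t) x) (x - x₀) = 0 := by
  -- a toroidal field is tangent to the spheres: `⟪y, a × y⟫ = 0`
  have hun : ∀ t < 0, ∀ x, ⟪x - x₀, curl (v t) x⟫ = 0 := fun t ht x => by
    rw [hrep t ht x]
    simp [cross, crossProduct, PiLp.inner_apply, Fin.sum_univ_three]
    ring
  have hev : ∀ t < 0, ∀ x, curl (v t) (x₀ + x₀ - x) = curl (v t) x := fun t ht =>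
    curl_reflect_of_even_potential (hrep t ht) (hTeven t ht)
  intro t ht x
  rw [← hrep t ht x]
  exact curl_eq_zero_of_curl_even_of_centre_ne_zero_farPast v x₀ hB hm hsm hun hev hne t ht x

end Summit.NavierStokesRegularity.NavierStokesRegularity.Theorems.PoloidalLiouville.Antidynamo

end
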